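import Summits.ValiantsHypothesis.ValiantsHypothesis.Theorems.FreeSubtorusOrbitDimensionBoundStubStableReductionLattice

/-!
# `OrbitDimensionBound` (stmt-ValiantsHypothesis-16133), rung line `filtered_covering` — stub `stub_polystableModel`,
# part 1: balanced complements in a semisimple pencil

Helper file (part 1) for stub 1 `stub_polystableModel` of `Cruxes/OrbitDimensionBound/Lines/filtered_covering.lean`
(route `FreeSubtorus`, rung `Depth.FilteredShadow`), in the abstract setting of
`…StubStableReductionLattice` (a family of linear maps `F i : E → E'` between finite-dimensional spaces; `W(V) = ⨆ i, F i V`;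
semistable = `dim V ≤ dim W(V)`; balanced = `dim W(V) ≤ dim V`; atom = minimal non-zero balanced subspace).

* `finrank_finsetSup_le_sum` — `dim (⨆_{A ∈ T} A) ≤ ∑_{A ∈ T} dim A`;
* **`exists_balanced_compl_of_finsetSup_eq_top`** — if `E` is the join of a finite set `T` of atoms (the pencil is
  SEMISIMPLE), every balanced subspace `U` has a balanced complement `C` (`U ⊓ C = ⊥`, `U ⊔ C = ⊤`): take a maximal
  sub-family of `T` direct with `U`; every atom of `T` then lies in `U ⊔ C` (else it could be added), so `U ⊔ C = ⊤`;
* `exists_balanced_compl_between` — the relative version `V' = U ⊕ C` for balanced `U ≤ V'` (modular law).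

These feed the degeneration-closedness of semisimple pencils (part 2): the levels of a one-parameter degeneration are
balanced sub-pencils, which split.

Helper mode (`--supports stmt-ValiantsHypothesis-16133 --as helper`).  Honest framing: [folklore] linear algebra toward
ONE registered stub (`stub_polystableModel`, L) of a dormant rung line whose other stub `stub_jordanHolder` (L, hardest) is
OPEN; the crux `OrbitDimensionBound`, the route `FreeSubtorus` and VP ≠ VNP are OPEN and are not moved by this file.

## References (orientation only)
* A. D. King, Quart. J. Math. 45 (1994), §3 (semisimple objects of the abelian category of `θ`-semistables).
-/

set_option linter.dupNamespace false

namespace Summit.ValiantsHypothesis.ValiantsHypothesis.Theorems.FreeSubtorusOrbitDimensionBound.SquareCovering.StableReduction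

open Module Submodule

variable {K : Type*} [Field K] {E E' : Type*} [AddCommGroup E] [Module K E] [AddCommGroup E'] [Module K E']
  {ι : Type*} (F : ι → E →ₗ[K] E')

section Complement

variable [FiniteDimensional K E] [FiniteDimensional K E']

omit [FiniteDimensional K E'] in
/-- The dimension of a finite join is at most the sum of the dimensions. [folklore] -/
theorem finrank_finsetSup_le_sum (T : Finset (Submodule K E)) :
    finrank K ↥(T.sup id) ≤ ∑ A ∈ T, finrank K A := by
  classical
  induction T using Finset.induction_on with
  | empty => simp
  | insert A T hA ih =>
    rw [Finset.sup_insert, Finset.sum_insert hA, id]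
    exact (Submodule.finrank_add_le_finrank_add_finrank _ _).trans (by omega)

/-- **Balanced complements in a semisimple pencil.**  If `E` is the join of a finite set `T` of atoms, every balanced
subspace `U` has a balanced complement. [folklore] -/
theorem exists_balanced_compl_of_finsetSup_eq_top
    (hss : ∀ V : Submodule K E, finrank K V ≤ finrank K ↥(⨆ i, V.map (F i)))
    (T : Finset (Submodule K E))
    (hT : ∀ A ∈ T, A ≠ ⊥ ∧ finrank K ↥(⨆ i, A.map (F i)) ≤ finrank K A ∧
      ∀ A' : Submodule K E, A' ≤ A → A' ≠ ⊥ → finrank K ↥(⨆ i, A'.map (F i)) ≤ finrank K A' → A' = A)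
    (hTtop : T.sup id = ⊤) {U : Submodule K E} (hU : finrank K ↥(⨆ i, U.map (F i)) ≤ finrank K U) :
    ∃ C : Submodule K E, finrank K ↥(⨆ i, C.map (F i)) ≤ finrank K C ∧ U ⊓ C = ⊥ ∧ U ⊔ C = ⊤ := by
  classical
  -- `P N`: a sub-family of `T` with `N` members which is direct together with `U`
  let P : ℕ → Prop := fun N => ∃ T' : Finset (Submodule K E), T' ⊆ T ∧ T'.card = N ∧
    finrank K ↥(U ⊔ T'.sup id) = finrank K U + ∑ A ∈ T', finrank K A
  have hP0 : P 0 := ⟨∅, Finset.empty_subset _, rfl, by rw [Finset.sup_empty, Finset.sum_empty, sup_bot_eq, add_zero]⟩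
  have hbound : ∀ N, P N → N ≤ T.card := by
    rintro N ⟨T', hT'T, rfl, -⟩
    exact Finset.card_le_card hT'T
  obtain ⟨T', hT'T, hcard, hsum⟩ : P (Nat.findGreatest P T.card) := Nat.findGreatest_spec (Nat.zero_le _) hP0
  set C : Submodule K E := T'.sup id with hCdef
  have hCbal : finrank K ↥(⨆ i, C.map (F i)) ≤ finrank K C :=
    balanced_finsetSup F hss T' fun A hA => (hT A (hT'T hA)).2.1
  have hUCbal : finrank K ↥(⨆ i, (U ⊔ C).map (F i)) ≤ finrank K ↥(U ⊔ C) := balanced_sup F hss hU hCbal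
  -- every atom of `T` lies in `U ⊔ C`
  have key : ∀ A ∈ T, A ≤ U ⊔ C := by
    intro A hA
    by_contra hAle
    obtain ⟨hA0, hAbal, hAmin⟩ := hT A hA
    have hinf : A ⊓ (U ⊔ C) = ⊥ := by
      by_contra hne
      have h1 := hAmin _ inf_le_left hne (balanced_inf F hss hAbal hUCbal)
      exact hAle (h1 ▸ inf_le_right)
    have hAT' : A ∉ T' := fun h => hAle ((Finset.le_sup (f := id) h).trans le_sup_right)
    have hP' : P (Nat.findGreatest P T.card + 1) := by
      refine ⟨insert A T', Finset.insert_subset hA hT'T, by rw [Finset.card_insert_of_notMem hAT', hcard], ?_⟩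
      rw [Finset.sum_insert hAT', Finset.sup_insert, id, ← hCdef]
      have h1 := Submodule.finrank_sup_add_finrank_inf_eq (U ⊔ C) A
      rw [inf_comm, hinf, finrank_bot, add_zero] at h1
      have h2 : U ⊔ (A ⊔ C) = (U ⊔ C) ⊔ A := by rw [sup_comm A C, sup_assoc]
      rw [h2, h1, hsum]
      ring
    exact Nat.findGreatest_is_greatest (lt_add_one _) (hbound _ hP') hP'
  have htop : U ⊔ C = ⊤ := by
    refine top_le_iff.1 ?_
    rw [← hTtop]
    exact Finset.sup_le fun A hA => key A hA
  refine ⟨C, hCbal, ?_, htop⟩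
  -- directness: `dim (U ⊔ C) = dim U + ∑ dim A ≥ dim U + dim C`
  have h1 := Submodule.finrank_sup_add_finrank_inf_eq U C
  have h2 : finrank K C ≤ ∑ A ∈ T', finrank K A := finrank_finsetSup_le_sum T'
  have h3 : finrank K ↥(U ⊓ C) = 0 := by omega
  exact Submodule.finrank_eq_zero.1 h3

/-- **Relative complements** (modular law): for balanced `U ≤ V'` in a semisimple pencil there is a balanced `C` with
`U ⊓ C = ⊥` and `U ⊔ C = V'`. [folklore] -/
theorem exists_balanced_compl_between
    (hss : ∀ V : Submodule K E, finrank K V ≤ finrank K ↥(⨆ i, V.map (F i)))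
    (hcompl : ∀ U : Submodule K E, finrank K ↥(⨆ i, U.map (F i)) ≤ finrank K U →
      ∃ C : Submodule K E, finrank K ↥(⨆ i, C.map (F i)) ≤ finrank K C ∧ U ⊓ C = ⊥ ∧ U ⊔ C = ⊤)
    {U V' : Submodule K E} (hU : finrank K ↥(⨆ i, U.map (F i)) ≤ finrank K U)
    (hV' : finrank K ↥(⨆ i, V'.map (F i)) ≤ finrank K V') (hUV' : U ≤ V') :
    ∃ C : Submodule K E, finrank K ↥(⨆ i, C.map (F i)) ≤ finrank K C ∧ C ≤ V' ∧ U ⊓ C = ⊥ ∧ U ⊔ C = V' := by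
  obtain ⟨C₀, hC₀bal, hC₀inf, hC₀sup⟩ := hcompl U hU
  refine ⟨C₀ ⊓ V', balanced_inf F hss hC₀bal hV', inf_le_right, ?_, ?_⟩
  · rw [← inf_assoc, hC₀inf, bot_inf_eq]
  · rw [← sup_inf_assoc_of_le C₀ hUV', hC₀sup, top_inf_eq]

end Complement

end Summit.ValiantsHypothesis.ValiantsHypothesis.Theorems.FreeSubtorusOrbitDimensionBound.SquareCovering.StableReduction
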